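import Literature.MathematicalPhysics.QuantumLattice.SpinGaugeTransformations
import HarnessLib

/-!
# Block calculus of the spin-gauged Hubbard torus over the link basis

Family `hubbard` (trunk T-QLATTICE). API for `spinGaugedHubbardTorusWith ρ L U gE gB`
(`SpinGaugedHubbardTorus`) organised around the block-diagonal calculus
`SpinGauged.linkDiag S = Σ_k S(k) ⊗ |k⟩⟨k|` of `SpinGaugeTransformations`:

* quadratic forms of block-diagonal operators decompose over the link configuration,
  `⟨Ψ, (Σ_k S(k) ⊗ |k⟩⟨k|) Ψ⟩ = Σ_k ⟨Ψ_k, S(k) Ψ_k⟩`, `Ψ_k = Ψ(·, k)` (`star_dotProduct_linkDiag_mulVec`,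
  `star_dotProduct_self_eq_sum_link`), and `(linkDiag S)|_{(·,k)} = S k` (`submatrix_linkDiag`);
* the Hamiltonian splits as `H = A + gE · (1 ⊗ Σ_b E_b) + gB · (1 ⊗ Σ_p w_p)` with the gauge–fermion
  part `A = spinGaugedHubbardTorusWith ρ L U 0 0` (`spinGaugedHubbardTorusWith_eq_add`), and `A` is
  BLOCK DIAGONAL in the link configuration: `A = Σ_k H_F(k) ⊗ |k⟩⟨k|` with the FROZEN-LINK fermion
  Hamiltonian `H_F(k) = -Σ_b (S_b(ρ(k_b)) + h.c.) + U Σ_x n_{x↑}n_{x↓} = A|_{(·,k)(·,k)}`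
  (`spinGaugedHubbardTorusWith_zero_zero_eq_linkDiag`, `…_eq_linkDiag_submatrix`); likewise the pair
  order observable `Δ^g† Δ^g = Σ_k (P_k† P_k) ⊗ |k⟩⟨k|`, `P_k = Δ^g|_{(·,k)(·,k)}`
  (`pairOrder_eq_linkDiag_submatrix`);
* PARTICLE-NUMBER CONSERVATION: every term carries charge `0` for the grading `#(occupied orbitals)`
  (`hasShift_card_spinGaugedHubbardTorusWith`), so matrix entries between different particle numbers
  vanish (`spinGaugedHubbardTorusWith_apply_of_card_ne`) and the frozen blocks preserve the
  `N`-particle sector (`submatrix_mulVec_mem_nParticleSubmodule`).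

No definitions. Kogut–Susskind, PRD 11 (1975) 395 (the Hamiltonian is a function of the links plus
the electric term); all statements are folklore bookkeeping.

## Mathlib / tree search

Mathlib: `Matrix.kroneckerMap`, `Matrix.submatrix`, `Fintype.sum_prod_type`, `Finset.sum_comm`.
Tree (REUSED): `SpinGauged.linkDiag` + `linkDiag_apply/_add/_smul/_mul/_conjTranspose`,
`hop_eq_linkDiag`, `spinGaugedPairFieldWith_eq_linkDiag`, `kronecker_one_eq_linkDiag`
(`SpinGaugeTransformations`); `GaugedHubbard.HasShift` calculus and `hasShift_creation/annihilation`
(`GaugedHubbardTorus`); `nParticleSubmodule` (`FermionOperators`).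
-/

noncomputable section

namespace Literature.MathematicalPhysics.QuantumLattice

open Matrix Finset GaugedHubbard
open scoped Kronecker

namespace SpinGauged

/-! ### Quadratic forms of block-diagonal operators -/

section LinkDiagForms

variable {F K : Type*} [Fintype F] [Fintype K] [DecidableEq K]

/-- Components of `(Σ_k S(k) ⊗ |k⟩⟨k|) Ψ`: at `(s, k)` it is `(S(k) Ψ_k)(s)`, `Ψ_k = Ψ(·, k)`.
[folklore] -/
theorem linkDiag_mulVec_apply (S : K → Matrix F F ℂ) (Ψ : F × K → ℂ) (a : F × K) :
    (linkDiag S *ᵥ Ψ) a = (S a.2 *ᵥ fun s => Ψ (s, a.2)) a.1 := by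
  rw [mulVec, dotProduct, Fintype.sum_prod_type, mulVec, dotProduct]
  refine Finset.sum_congr rfl fun s _ => ?_
  rw [Finset.sum_eq_single a.2]
  · rw [linkDiag_apply, if_pos rfl]
  · intro k _ hk
    rw [linkDiag_apply, if_neg (Ne.symm hk), zero_mul]
  · intro h
    exact absurd (Finset.mem_univ _) h

/-- **Quadratic forms of block-diagonal operators decompose over the link configuration**:
`⟨Ψ, (Σ_k S(k) ⊗ |k⟩⟨k|) Ψ⟩ = Σ_k ⟨Ψ_k, S(k) Ψ_k⟩`. [folklore] -/
theorem star_dotProduct_linkDiag_mulVec (S : K → Matrix F F ℂ) (Ψ : F × K → ℂ) :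
    star Ψ ⬝ᵥ linkDiag S *ᵥ Ψ =
      ∑ k, star (fun s => Ψ (s, k)) ⬝ᵥ S k *ᵥ (fun s => Ψ (s, k)) := by
  simp only [dotProduct, Pi.star_apply, linkDiag_mulVec_apply]
  rw [Fintype.sum_prod_type, Finset.sum_comm]

omit [DecidableEq K] in
/-- `⟨Ψ, Ψ⟩ = Σ_k ⟨Ψ_k, Ψ_k⟩`. [folklore] -/
theorem star_dotProduct_self_eq_sum_link (Ψ : F × K → ℂ) :
    star Ψ ⬝ᵥ Ψ = ∑ k, star (fun s => Ψ (s, k)) ⬝ᵥ (fun s => Ψ (s, k)) := by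
  simp only [dotProduct, Pi.star_apply]
  rw [Fintype.sum_prod_type, Finset.sum_comm]

omit [Fintype F] [Fintype K] in
/-- The `(·,k)(·,k)` compression of `Σ_k S(k) ⊗ |k⟩⟨k|` is `S k`. [folklore] -/
theorem submatrix_linkDiag (S : K → Matrix F F ℂ) (k : K) :
    (linkDiag S).submatrix (fun s => (s, k)) (fun s => (s, k)) = S k := by
  ext s s'
  simp [linkDiag_apply]

omit [Fintype F] [Fintype K] in
/-- A block-diagonal operator is determined by its diagonal blocks. [folklore] -/
theorem linkDiag_submatrix_linkDiag (S : K → Matrix F F ℂ) :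
    linkDiag (fun k => (linkDiag S).submatrix (fun s => (s, k)) (fun s => (s, k))) = linkDiag S := by
  simp only [submatrix_linkDiag]

end LinkDiagForms

/-! ### The Hamiltonian: coupling split and block-diagonal gauge–fermion part -/

section Hamiltonian

variable {G : Type*} [Group G] [Fintype G] [DecidableEq G]
variable (ρ : G →* Matrix (Fin 2) (Fin 2) ℂ) (L : ℕ) [NeZero L]

/-- **Coupling split**: `H(gE, gB) = A + gE · (1 ⊗ Σ_b E_b) + gB · (1 ⊗ Σ_p w_p)` with the
gauge–fermion part `A = H(0, 0)`. [folklore] -/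
theorem spinGaugedHubbardTorusWith_eq_add (U gE gB : ℝ) :
    spinGaugedHubbardTorusWith ρ L U gE gB = spinGaugedHubbardTorusWith ρ L U 0 0 +
      (gE : ℂ) • ((1 : Matrix (Finset (Orb (FermionTorus 2 L))) _ ℂ) ⊗ₖ electric L) +
      (gB : ℂ) • ((1 : Matrix (Finset (Orb (FermionTorus 2 L))) _ ℂ) ⊗ₖ magnetic ρ L) := by
  unfold spinGaugedHubbardTorusWith
  simp only [Complex.ofReal_zero, zero_smul, add_zero]

/-- **The gauge–fermion part is block diagonal in the link configuration**:
`A = Σ_k H_F(k) ⊗ |k⟩⟨k|` with the frozen-link fermion Hamiltonian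
`H_F(k) = -(T(k) + T(k)ᴴ) + U Σ_x n_{x↑} n_{x↓}`, `T(k) = Σ_b S_b(ρ(k_b))`. Kogut–Susskind (1975).
[folklore] -/
theorem spinGaugedHubbardTorusWith_zero_zero_eq_linkDiag (U : ℝ) :
    spinGaugedHubbardTorusWith ρ L U 0 0 = linkDiag (fun k : Bond L → G =>
      -((∑ b : Bond L, spinBil b.1 (b.1.shift b.2) (ρ (k b))) +
          (∑ b : Bond L, spinBil b.1 (b.1.shift b.2) (ρ (k b)))ᴴ) +
        (U : ℂ) • ∑ x : FermionTorus 2 L, numberOp x 0 * numberOp x 1) := by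
  unfold spinGaugedHubbardTorusWith
  rw [hop_eq_linkDiag, linkDiag_conjTranspose, kronecker_one_eq_linkDiag]
  simp only [Complex.ofReal_zero, zero_smul, add_zero]
  ext ⟨s, k⟩ ⟨s', k'⟩
  simp only [Matrix.add_apply, Matrix.neg_apply, Matrix.smul_apply, linkDiag_apply, smul_eq_mul]
  split_ifs with h
  · subst h
    rfl
  · simp

/-- The gauge–fermion part is the block-diagonal operator of its own `(·,k)(·,k)` compressions
(the frozen-link Hamiltonians). [folklore] -/
theorem spinGaugedHubbardTorusWith_zero_zero_eq_linkDiag_submatrix (U : ℝ) :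
    spinGaugedHubbardTorusWith ρ L U 0 0 = linkDiag (fun k : Bond L → G =>
      (spinGaugedHubbardTorusWith ρ L U 0 0).submatrix (fun s => (s, k)) (fun s => (s, k))) := by
  conv_rhs => rw [spinGaugedHubbardTorusWith_zero_zero_eq_linkDiag ρ L U]
  rw [linkDiag_submatrix_linkDiag, ← spinGaugedHubbardTorusWith_zero_zero_eq_linkDiag]

/-- **The pair order observable is block diagonal**: `Δ^g† Δ^g = Σ_k (P_k† P_k) ⊗ |k⟩⟨k|` with
`P_k` the `(·,k)(·,k)` compression of the transported pair field. [folklore] -/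
theorem pairOrder_eq_linkDiag_submatrix :
    (spinGaugedPairFieldWith ρ L)ᴴ * spinGaugedPairFieldWith ρ L = linkDiag (fun k : Bond L → G =>
      ((spinGaugedPairFieldWith ρ L).submatrix (fun s => (s, k)) (fun s => (s, k)))ᴴ *
        (spinGaugedPairFieldWith ρ L).submatrix (fun s => (s, k)) (fun s => (s, k))) := by
  conv_lhs => rw [spinGaugedPairFieldWith_eq_linkDiag ρ L, linkDiag_conjTranspose, linkDiag_mul]
  congr 1
  funext k
  rw [spinGaugedPairFieldWith_eq_linkDiag ρ L, submatrix_linkDiag]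

end Hamiltonian

/-! ### Particle-number conservation -/

section Number

variable {G : Type*} [Group G] [Fintype G] [DecidableEq G]
variable (ρ : G →* Matrix (Fin 2) (Fin 2) ℂ) (L : ℕ) [NeZero L]

/-- The orbital-counting weight is the particle number: `wt 1 s = #s`. [folklore] -/
theorem wt_one_eq_card {ι' : Type*} (s : Finset ι') : wt (fun _ : ι' => (1 : ℤ)) s = s.card := by
  simp [wt]

omit [NeZero L] in
/-- A hopping bilinear `c†_{xσ} c_{x'τ}` conserves the particle number. [folklore] -/
theorem hasShift_card_creation_mul_annihilation (p q : Orb (FermionTorus 2 L)) :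
    HasShift (wt fun _ : Orb (FermionTorus 2 L) => (1 : ℤ)) (creation p * annihilation q) 0 :=
  ((hasShift_creation (fun _ => (1 : ℤ)) p).mul (hasShift_annihilation (fun _ => (1 : ℤ)) q)).of_eq
    (by norm_num)

/-- **Every term of the spin-gauged Hubbard torus conserves the particle number**: `H(gE, gB)`
carries charge `0` for the grading `(s, k) ↦ #s`. Kogut–Susskind (1975) (`[H, N] = 0`). [folklore] -/
theorem hasShift_card_spinGaugedHubbardTorusWith (U gE gB : ℝ) :
    HasShift (fun ik : Index L G => wt (fun _ : Orb (FermionTorus 2 L) => (1 : ℤ)) ik.1)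
      (spinGaugedHubbardTorusWith ρ L U gE gB) 0 := by
  have hgrade : (fun ik : Index L G =>
      wt (fun _ : Orb (FermionTorus 2 L) => (1 : ℤ)) ik.1 + (fun _ : Bond L → G => (0 : ℤ)) ik.2) =
      fun ik => wt (fun _ : Orb (FermionTorus 2 L) => (1 : ℤ)) ik.1 := by
    funext ik
    simp
  -- the covariant hopping
  have hhop : HasShift (fun ik : Index L G => wt (fun _ : Orb (FermionTorus 2 L) => (1 : ℤ)) ik.1)
      (hop ρ L) 0 := by
    unfold hop
    refine HasShift.sum _ fun b _ => HasShift.sum _ fun σ _ => HasShift.sum _ fun τ _ => ?_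
    exact (((hasShift_card_creation_mul_annihilation L (orb b.1 σ) (orb (b.1.shift b.2) τ)).kronecker
      (HasShift.diagonal (d := fun _ : Bond L → G => (0 : ℤ)) _)).congr_grading hgrade).of_eq
        (by norm_num)
  -- the interaction
  have hint : HasShift (fun ik : Index L G => wt (fun _ : Orb (FermionTorus 2 L) => (1 : ℤ)) ik.1)
      ((∑ x : FermionTorus 2 L, numberOp x 0 * numberOp x 1) ⊗ₖ
        (1 : Matrix (Bond L → G) (Bond L → G) ℂ)) 0 := by
    have hnn : HasShift (wt fun _ : Orb (FermionTorus 2 L) => (1 : ℤ))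
        (∑ x : FermionTorus 2 L, numberOp x 0 * numberOp x 1) 0 :=
      HasShift.sum _ fun x _ =>
        ((hasShift_card_creation_mul_annihilation L (orb x 0) (orb x 0)).mul
          (hasShift_card_creation_mul_annihilation L (orb x 1) (orb x 1))).of_eq (by norm_num)
    exact ((hnn.kronecker (HasShift.one (d := fun _ : Bond L → G => (0 : ℤ)))).congr_grading
      hgrade).of_eq (by norm_num)
  -- the pure link terms
  have hel : HasShift (fun ik : Index L G => wt (fun _ : Orb (FermionTorus 2 L) => (1 : ℤ)) ik.1)
      ((1 : Matrix (Finset (Orb (FermionTorus 2 L))) _ ℂ) ⊗ₖ electric L) 0 :=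
    ((HasShift.one.kronecker (HasShift.of_const (electric L) (0 : ℤ))).congr_grading hgrade).of_eq
      (by norm_num)
  have hmag : HasShift (fun ik : Index L G => wt (fun _ : Orb (FermionTorus 2 L) => (1 : ℤ)) ik.1)
      ((1 : Matrix (Finset (Orb (FermionTorus 2 L))) _ ℂ) ⊗ₖ magnetic ρ L) 0 :=
    ((HasShift.one.kronecker (HasShift.of_const (magnetic ρ L) (0 : ℤ))).congr_grading hgrade).of_eq
      (by norm_num)
  unfold spinGaugedHubbardTorusWith
  refine (((hhop.add ?_).neg.add (hint.smul _)).add (hel.smul _)).add (hmag.smul _)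
  simpa using hhop.conjTranspose

/-- **Matrix entries between different particle numbers vanish.** [folklore] -/
theorem spinGaugedHubbardTorusWith_apply_of_card_ne (U gE gB : ℝ) {s s' : Finset (Orb (FermionTorus 2 L))}
    (h : s.card ≠ s'.card) (k k' : Bond L → G) :
    spinGaugedHubbardTorusWith ρ L U gE gB (s, k) (s', k') = 0 := by
  refine (hasShift_card_spinGaugedHubbardTorusWith ρ L U gE gB).apply_eq_zero ?_
  simpa [wt_one_eq_card] using h

/-- **The frozen-link blocks preserve the `N`-particle sector.** [folklore] -/
theorem submatrix_mulVec_mem_nParticleSubmodule (U gE gB : ℝ) (k : Bond L → G) {N : ℕ}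
    {φ : Fock (Orb (FermionTorus 2 L))}
    (hφ : φ ∈ (nParticleSubmodule N : Submodule ℂ (Fock (Orb (FermionTorus 2 L))))) :
    (spinGaugedHubbardTorusWith ρ L U gE gB).submatrix (fun s => (s, k)) (fun s => (s, k)) *ᵥ φ ∈
      (nParticleSubmodule N : Submodule ℂ (Fock (Orb (FermionTorus 2 L)))) := by
  rw [mem_nParticleSubmodule_iff] at hφ ⊢
  intro s hs
  rw [mulVec, dotProduct]
  refine Finset.sum_eq_zero fun s' _ => ?_
  by_cases hs' : s'.card = N
  · rw [submatrix_apply, spinGaugedHubbardTorusWith_apply_of_card_ne ρ L U gE gB (by rw [hs']; exact hs),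
      zero_mul]
  · rw [hφ s' hs', mul_zero]

/-- Vectors supported in a particle-number block of the coupled system stay there under `H`: for
`Ψ` with `Ψ(s, k) = 0` unless `#s = N`, also `(H Ψ)(s, k) = 0` unless `#s = N`. [folklore] -/
theorem spinGaugedHubbardTorusWith_mulVec_apply_of_card_ne (U gE gB : ℝ) {N : ℕ} {Ψ : Index L G → ℂ}
    (hΨ : ∀ ik : Index L G, ik.1.card ≠ N → Ψ ik = 0) (ik : Index L G) (hik : ik.1.card ≠ N) :
    (spinGaugedHubbardTorusWith ρ L U gE gB *ᵥ Ψ) ik = 0 := by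
  rw [mulVec, dotProduct]
  refine Finset.sum_eq_zero fun jk _ => ?_
  by_cases hjk : jk.1.card = N
  · obtain ⟨s, k⟩ := ik
    obtain ⟨s', k'⟩ := jk
    rw [spinGaugedHubbardTorusWith_apply_of_card_ne ρ L U gE gB (by rw [hjk]; exact hik), zero_mul]
  · rw [hΨ jk hjk, mul_zero]

end Number

end SpinGauged

end Literature.MathematicalPhysics.QuantumLattice

end
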